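import Summits.SmoothPoincare4.SmoothPoincare4.Theorems.ConvexBisectionAcyclicBisectionExistsT3Assembly
import Summits.SmoothPoincare4.SmoothPoincare4.Theorems.ConvexBisectionAcyclicBisectionExistsBeltPageClause
import Summits.SmoothPoincare4.SmoothPoincare4.Theorems.ConvexBisectionAcyclicBisectionExistsDualDataRecord
import Summits.SmoothPoincare4.SmoothPoincare4.Theorems.ConvexBisectionAcyclicBisectionExistsSeamPageFunction
import HarnessLib

/-!
# Dual handles, T3: the contract with ALL landed wave-5 bricks plugged in — T3 from ST4 and the data node
(sub-goal of stub `stub_T3_dualPresentation` (T3), line `modp-braid-orbits` r12, crux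
`ConvexBisection.AcyclicBisectionExists`, item stmt-SmoothPoincare4-10508; wave 5, lead c5, worker X2;
registered sub-goal `helper_w_incl_ne_zero_of_belt`)

Sequel of `…T3Assembly.lean`: `T3_of_two_pieces (HST4) (Hgap)` — the registered text of
`stub_T3_dualPresentation` from X3's global twisting sign `node_ST4_twistSign` (`HST4`) and the unassigned
node "T3c-3 WITH DATA" (`Hgap`, text `X2Interfaces.HgapStatement`) ONLY, every other wave-5 brick being
LANDED and used directly (X1 `helper_exists_dualAttachmentData`, X5 `exists_seamPageFunction`, X4
`helper_dualPresentation_signPin`, X6 `T3_bind`, `helper_T3_connected`; same assembly as `T3_of_pieces`),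
and the belt clause `w ≠ 0` at the deep belt points of the seam (registered `helper_w_incl_ne_zero_of_belt`,
from V4's `helper_belt_pageClause`: `w = c · pageDir`, `c > 0`, `‖pageDir‖ = 1`).

Everything here is proved; the two remaining statements enter as hypotheses; no `sorry`.

## References
* R. İ. Baykur, *Kähler decomposition of 4-manifolds*, AGT 6 (2006), proof of Thm. 5.1. [Baykur2006]
* J. B. Etnyre, T. Fuller, *Realizing 4-manifolds as achiral Lefschetz fibrations*, IMRN (2006), Thm. 1. [EtnyreFuller2006]
-/

noncomputable section

-- the prescribed namespace `Summit.<P>.<Sub>.…` duplicates `SmoothPoincare4` (P = Sub)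
set_option linter.dupNamespace false

open scoped Manifold ContDiff Topology

namespace Summit.SmoothPoincare4.SmoothPoincare4.Theorems.AcyclicBisectionExists.ModpBraidOrbits

open Set Function Metric Filter Topology
open Literature.Topology.FourManifolds Literature.Topology.FourManifolds.HandleAttachingMap
  Literature.Topology.FourManifolds.LefschetzBase Literature.Geometry.Symplectic

/-! ### §1 The belt clause of the seam page function -/

/-- **At the deep belt points of the seam the page value is non-zero** (the clause `hbelt` of
`exists_seamPageFunction`): a seam point `bX.incl y = D.jB k b` off `range D.jA` has
`w ((bBase g).incl (Ψ y)) = c · pageDir |l| k` with `c > 0` (V4's `helper_belt_pageClause`), and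
`‖pageDir |l| k‖ = 1`. [cite: EtnyreFuller2006, Thm. 1 (proof, p. 8)] -/
theorem w_incl_ne_zero_of_belt (g : ℕ) (l : List ((Fin g ⊕ Fin g → ℤ) × Bool))
    {X : Type} [TopologicalSpace X] [T2Space X] [SecondCountableTopology X] [CompactSpace X]
    [ChartedSpace (EuclideanHalfSpace 4) X] [IsManifold (𝓡∂ 4) ∞ X]
    (h : Fin l.length → HandleAttachingMap 3 2 (Base g)) (D : MultiAttachmentData h (𝓡∂ 4) X)
    (bX : BoundaryData (𝓡∂ 4) X (𝓡 3)) (Ψ : bX.carrier ≃ₘ⟮𝓡 3, 𝓡 3⟯ (bBase g).carrier) (hlink : IsLefschetzLink g l h)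
    (hpage : ∀ (y : bX.carrier) (a : ↥(coresComplement h)), bX.incl y = D.jA a →
      ∃ c : ℝ, 0 < c ∧ w g ((bBase g).incl (Ψ y)).1 = (c : ℂ) * w g (a : Base g).1)
    (y : bX.carrier) (k : Fin l.length) (b : ↥(beltPiece 3 2)) (hy : bX.incl y = D.jB k b)
    (hdeep : bX.incl y ∉ range D.jA) : w g ((bBase g).incl (Ψ y)).1 ≠ 0 := by
  obtain ⟨c, hc, hw⟩ := helper_belt_pageClause g l X h D bX Ψ hlink hpage y k b hy hdeep
  rw [hw]
  refine mul_ne_zero (by exact_mod_cast hc.ne') fun h0 => ?_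
  have h1 := norm_pageDir l.length k
  rw [h0, norm_zero] at h1
  exact zero_ne_one h1

/-! ### §2 T3 from ST4 and the data node -/

set_option maxHeartbeats 800000 in
-- the two `τ`-bridges elaborate against a context of ~90 hypotheses with long dependent types
/-- **T3 from TWO statements.**  The registered text of `stub_T3_dualPresentation` from X3's global
twisting sign (`HST4` = `node_ST4_twistSign`) and the unassigned node "T3c-3 WITH DATA" (`Hgap`); ALL
other bricks of wave 5 are LANDED and used directly: V5/Y5/Y6 (T3b), X1 `helper_exists_dualAttachmentData`,
Y1 + Y3 + Z7 (T3c), X4 `helper_dualPresentation_signPin`, X5 `exists_seamPageFunction`, X6 `T3_bind`,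
`helper_T3_connected`.  Same proof as `T3_of_pieces` (whose `HF` hypothesis was X5's draft binder list; the
landed `exists_seamPageFunction` takes the dual handles in the glued handle chart, i.e. X1's clause (E2)
itself). [cite: Baykur2006, Thm. 5.1 (proof, pp. 13–14)] -/
theorem T3_of_two_pieces
    (HST4 : ∀ (g : ℕ) (l : List ((Fin g ⊕ Fin g → ℤ) × Bool)) (h : Fin l.length → HandleAttachingMap 3 2 (Base g)) (hlink : IsLefschetzLink g l h) {X : Type} [TopologicalSpace X] [T2Space X] [SecondCountableTopology X] [CompactSpace X] [ChartedSpace (EuclideanHalfSpace 4) X] [IsManifold (𝓡∂ 4) ∞ X] (D : MultiAttachmentData h (𝓡∂ 4) X) (bX : BoundaryData (𝓡∂ 4) X (𝓡 3)) (Ψ : bX.carrier ≃ₘ⟮𝓡 3, 𝓡 3⟯ (bBase g).carrier) (hpage : ∀ (y : bX.carrier) (a : ↥(coresComplement h)), bX.incl y = D.jA a → ∃ c : ℝ, 0 < c ∧ w g ((bBase g).incl (Ψ y)).1 = (c : ℂ) * w g (a : Base g).1), ∃ s₀ : ℤ, (s₀ = 1 ∨ s₀ = -1) ∧ ∀ (c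 : ℂ) (_ : ‖c‖ = 1) (K : sphere (0 : EuclideanSpace ℝ (Fin 2)) 1 → Base g) (ν : sphere (0 : EuclideanSpace ℝ (Fin 2)) 1 → EuclideanSpace ℝ (Fin 4)) (hK : ∀ θ, K θ ∈ coresComplement h) (_ : ∀ θ, K θ ∈ page g c) (_ : IsBoundaryKnot K) (_ : IsKnotFraming K ν) (z : sphere (0 : EuclideanSpace ℝ (Fin 2)) 1 → bX.carrier) (_ : ∀ θ, bX.incl (z θ) = D.jA ⟨K θ, hK θ⟩) (u : sphere (0 : EuclideanSpace ℝ (Fin 2)) 1 → EuclideanSpace ℝ (Fin 3)) (_ : ∀ θ, mfderiv (𝓡 3) (𝓡∂ 4) bX.incl (z θ) (u θ) = mfderiv (𝓡∂ 4) (𝓡∂ 4) (fun a : ↥(coresComplement h) => D.jA a) ⟨K θ, hK θ⟩ (ν θ)) (R : AmbientIsotopy (𝓡∂ 4) (Base g)) (_ : ∀ (t : ℝ) (x : Base g), rho g (R.toFun t x).1 = rho g x.1) (_ : ∀ (t : ℝ) (x : Base g), ∃ r : ℝ, 0 < r ∧ w g (R.toFun t x).1 = (r : ℂ) * w g x.1)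 (_ : ∀ θ, R.toFun 1 ((bBase g).incl (Ψ (z θ))) ∈ page g c), pageTwisting g (R.toFun 1 ∘ fun θ => ((bBase g).incl (Ψ (z θ)) : Base g)) (fun θ => mfderiv (𝓡∂ 4) (𝓡∂ 4) (R.toFun 1) ((bBase g).incl (Ψ (z θ))) (mfderiv (𝓡 3) (𝓡∂ 4) (fun y => ((bBase g).incl (Ψ y) : Base g)) (z θ) (u θ))) = s₀ * pageTwisting g K ν)
    (Hgap : ∀ (g : ℕ) (P N : List ((Fin g ⊕ Fin g → ℤ) × Bool)) (h : Fin (P ++ N).length → HandleAttachingMap 3 2 (Base g)) (hlink : IsLefschetzLink g (P ++ N) h) {X : Type} [TopologicalSpace X] [T2Space X] [SecondCountableTopology X] [CompactSpace X] [ChartedSpace (EuclideanHalfSpace 4) X] [IsManifold (𝓡∂ 4) ∞ X] (D : MultiAttachmentData h (𝓡∂ 4) X) (bX : BoundaryData (𝓡∂ 4) X (𝓡 3)) (Ψ : bX.carrier ≃ₘ⟮𝓡 3, 𝓡 3⟯ (bBase g).carrier) (hpage : ∀ (y : bX.carrier) (a : ↥(coresComplement h)), bX.incl y = D.jA a → ∃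 c : ℝ, 0 < c ∧ w g ((bBase g).incl (Ψ y)).1 = (c : ℂ) * w g (a : Base g).1) {X₁ : Type} [TopologicalSpace X₁] [T2Space X₁] [SecondCountableTopology X₁] [CompactSpace X₁] [ChartedSpace (EuclideanHalfSpace 4) X₁] [IsManifold (𝓡∂ 4) ∞ X₁] (D₁ : MultiAttachmentData (fun i : Fin P.length => h (Fin.cast List.length_append.symm (Fin.castAdd N.length i))) (𝓡∂ 4) X₁) {W₂ : Type} [TopologicalSpace W₂] [T2Space W₂] [SecondCountableTopology W₂] [CompactSpace W₂] [ChartedSpace (EuclideanHalfSpace 4) W₂] [IsManifold (𝓡∂ 4) ∞ W₂] (b₂ : BoundaryData (𝓡∂ 4) W₂ (𝓡 3)) (φ : (BoundaryManifold.boundaryData 3 X₁).carrier ≃ₘ⟮𝓡 3, 𝓡 3⟯ b₂.carrier) (col : (BoundaryManifold.boundaryData 3 (Base g)).Collar) (κ δ : ℝ) (hκ : 0 < κ) (hκ1 : κ ≤ 1) (hδ : 0 < δ) (hδ2 : δ ≤ 1 / 2) (D₂ : MultiAttachmentData (fun j : Fin N.length => dualMap D bX (bBase g) Ψ col κ δ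 hκ hκ1 hδ hδ2 (Fin.cast List.length_append.symm (Fin.natAdd P.length j))) (𝓡∂ 4) W₂) (hseam : ∀ (y : (BoundaryManifold.boundaryData 3 X₁).carrier) (a : ↥(coresComplement h)) (ha₁ : (a : Base g) ∈ coresComplement (fun i : Fin P.length => h (Fin.cast List.length_append.symm (Fin.castAdd N.length i)))) (z : bX.carrier) (hz : D.jA a = bX.incl z), (BoundaryManifold.boundaryData 3 X₁).incl y = D₁.jA ⟨a, ha₁⟩ → (∀ (j : Fin N.length) (t : ↥(handleTube 3 2)), (h (Fin.cast List.length_append.symm (Fin.natAdd P.length j))).toFun t = (a : Base g) → ‖lamPart ((t : closedBall (0 : EuclideanSpace ℝ (Fin 4)) 1) : EuclideanSpace ℝ (Fin 4))‖ ^ 2 ≤ 1 - 3 * κ ^ 2 / 4) → b₂.incl (φ y) = D₂.jA ⟨(bBase g).incl (Ψ z), incl_mem_coresComplement_dualMap D bX (bBase g) Ψ col κ δ hκ hκ1 hδ hδ2 (fun j : Fin N.length => Fin.cast List.length_append.symm (Fin.natAdd P.length j)) z a hz⟩) (s' : Bool) (h' : Fin N.length → HandleAttachingMap 3 2 (Base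 g)) (_ : ∀ j, ∃ c : ℂ, ‖c‖ = 1 ∧ ∀ θ, (h' j).attachingCircle θ ∈ page g c) (_ : ∀ j, shadow g (h' j).attachingCircle (h' j).continuous_attachingCircle ≠ 0) (_ : ∀ j, pageTwisting g (h' j).attachingCircle (h' j).attachingFraming = if s' then -1 else 1) (_ : Pairwise fun i j => Disjoint (range (h' i).toFun) (range (h' j).toFun)) (_ : HandleAttachingMap.IsMultiAttachment h' (𝓡∂ 4) W₂), ∃ (q₂ : Fin N.length → HandleAttachingMap 3 2 (Base g)) (D₂p : MultiAttachmentData q₂ (𝓡∂ 4) W₂) (s : Bool), (∀ j, ∃ c : ℂ, ‖c‖ = 1 ∧ ∀ θ, (q₂ j).attachingCircle θ ∈ page g c) ∧ (∀ j, shadow g (q₂ j).attachingCircle (q₂ j).continuous_attachingCircle ≠ 0) ∧ (∀ j, pageTwisting g (q₂ j).attachingCircle (q₂ j).attachingFraming = if s then -1 else 1) ∧ (∃ (y₀ : (BoundaryManifold.boundaryData 3 X₁).carrier) (a₁ : ↥(coresComplement (fun i : Fin P.length => h (Fin.cast List.length_append.symm (Fin.castAdd N.length i))))) (a₂ : ↥(coresComplement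 q₂)), (BoundaryManifold.boundaryData 3 X₁).incl y₀ = D₁.jA a₁ ∧ b₂.incl (φ y₀) = D₂p.jA a₂ ∧ ∀ (uu : Fin 3 → EuclideanSpace ℝ (Fin 3)) (v₁ v₂ : Fin 3 → EuclideanSpace ℝ (Fin 4)), (∀ k, mfderiv (𝓡 3) (𝓡∂ 4) (BoundaryManifold.boundaryData 3 X₁).incl y₀ (uu k) = mfderiv (𝓡∂ 4) (𝓡∂ 4) D₁.jA a₁ (v₁ k)) → (∀ k, mfderiv (𝓡 3) (𝓡∂ 4) (b₂.incl ∘ φ) y₀ (uu k) = mfderiv (𝓡∂ 4) (𝓡∂ 4) D₂p.jA a₂ (v₂ k)) → IsPosBdryFrame (fun i : Fin P.length => h (Fin.cast List.length_append.symm (Fin.castAdd N.length i))) a₁ v₁ → 0 < (if s then (1 : ℝ) else -1) * det4 (gradient (rho g) (a₂ : Base g).1) (ambientC q₂ a₂ (v₂ 0)) (ambientC q₂ a₂ (v₂ 1)) (ambientC q₂ a₂ (v₂ 2))) ∧ (∀ ap : ↥(coresComplement q₂), ∃ (a' : ↥(coresComplement (fun j : Fin N.length => dualMap D bX (bBase g)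 Ψ col κ δ hκ hκ1 hδ hδ2 (Fin.cast List.length_append.symm (Fin.natAdd P.length j))))) (c : ℝ), 0 < c ∧ D₂p.jA ap = D₂.jA a' ∧ w g (ap : Base g).1 = (c : ℂ) * w g (a' : Base g).1) ∧ (∀ a' : ↥(coresComplement (fun j : Fin N.length => dualMap D bX (bBase g) Ψ col κ δ hκ hκ1 hδ hδ2 (Fin.cast List.length_append.symm (Fin.natAdd P.length j)))), ∃ ap : ↥(coresComplement q₂), D₂p.jA ap = D₂.jA a')) :
    ∀ (M : Type) [TopologicalSpace M] [T2Space M] [SecondCountableTopology M] [ChartedSpace (EuclideanSpace ℝ (Fin 4)) M] [IsManifold (𝓡 4) ∞ M] (g : ℕ) (P N : List ((Fin g ⊕ Fin g → ℤ) × Bool)), Literature.Topology.FourManifolds.LefschetzBase.ModelsOnFibred M g (P ++ N) → (∀ x ∈ N, x.2 = false) → (∀ x ∈ P ++ N, x.1 ≠ 0) → ∃ (h : Fin (P ++ N).length → Literature.Topology.FourManifolds.HandleAttachingMap 3 2 (Literature.Topology.FourManifolds.LefschetzBase.Base g)) (X₁ : Type) (_ : TopologicalSpace X₁) (_ : T2Space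 X₁) (_ : SecondCountableTopology X₁) (_ : CompactSpace X₁) (_ : ChartedSpace (EuclideanHalfSpace 4) X₁) (_ : IsManifold (𝓡∂ 4) ∞ X₁) (D₁ : Literature.Topology.FourManifolds.HandleAttachingMap.MultiAttachmentData (fun i : Fin P.length => h (Fin.cast List.length_append.symm (Fin.castAdd N.length i))) (𝓡∂ 4) X₁) (W₂ : Type) (_ : TopologicalSpace W₂) (_ : ChartedSpace (EuclideanHalfSpace 4) W₂) (_ : IsManifold (𝓡∂ 4) ∞ W₂) (_ : CompactSpace W₂) (_ : T2Space W₂) (_ : SecondCountableTopology W₂) (b₁ : Literature.Topology.FourManifolds.BoundaryData (𝓡∂ 4) X₁ (𝓡 3)) (b₂ : Literature.Topology.FourManifolds.BoundaryData (𝓡∂ 4) W₂ (𝓡 3)) (φ : b₁.carrier ≃ₘ⟮𝓡 3, 𝓡 3⟯ b₂.carrier) (h₂ : Fin N.length → Literature.Topology.FourManifolds.HandleAttachingMap 3 2 (Literature.Topology.FourManifolds.LefschetzBase.Base g)) (D₂ : Literature.Topology.FourManifolds.HandleAttachingMap.MultiAttachmentData h₂ (𝓡∂ 4) W₂) (F :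 b₁.carrier → ℂ), Literature.Topology.FourManifolds.LefschetzBase.IsLefschetzLink g (P ++ N) h ∧ Literature.Topology.FourManifolds.IsBoundaryGluing b₁ b₂ φ (𝓡 4) M ∧ (∀ j, ∃ c : ℂ, ‖c‖ = 1 ∧ ∀ θ, (h₂ j).attachingCircle θ ∈ Literature.Topology.FourManifolds.LefschetzBase.page g c) ∧ (∀ j, Literature.Topology.FourManifolds.LefschetzBase.shadow g (h₂ j).attachingCircle (h₂ j).continuous_attachingCircle ≠ 0) ∧ (∀ j, Literature.Topology.FourManifolds.LefschetzBase.pageTwisting g (h₂ j).attachingCircle (h₂ j).attachingFraming = -1) ∧ ContMDiff (𝓡 3) 𝓘(ℝ, ℂ) ∞ F ∧ (∀ y a, b₁.incl y = D₁.jA a → ∃ c : ℝ, 0 < c ∧ F y = c * Literature.Topology.FourManifolds.LefschetzBase.w g a.1.1) ∧ (∀ y a', b₂.incl (φ y) = D₂.jA a' → ∃ c : ℝ, 0 < c ∧ F y = c * Literature.Topology.FourManifolds.LefschetzBase.w g a'.1.1) ∧ (∀ y, F y = 0 → ∃ a, b₁.incl y = D₁.jA a) ∧ (∀ y, F y ≠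 0 → ∃ v : EuclideanSpace ℝ (Fin 3), ((starRingEnd ℂ) (F y) * @id ℂ (mfderiv (𝓡 3) 𝓘(ℝ, ℂ) F y v)).im ≠ 0) ∧ (∀ y a, b₁.incl y = D₁.jA a → Literature.Topology.FourManifolds.LefschetzBase.w g a.1.1 = 0 → ∃ a', b₂.incl (φ y) = D₂.jA a') ∧ (∃ (y : b₁.carrier) (a₁ : Literature.Topology.FourManifolds.HandleAttachingMap.coresComplement (fun i : Fin P.length => h (Fin.cast List.length_append.symm (Fin.castAdd N.length i)))) (a₂ : Literature.Topology.FourManifolds.HandleAttachingMap.coresComplement h₂) (uu : Fin 3 → EuclideanSpace ℝ (Fin 3)) (v₁ v₂ : Fin 3 → EuclideanSpace ℝ (Fin 4)), b₁.incl y = D₁.jA a₁ ∧ b₂.incl (φ y) = D₂.jA a₂ ∧ (∀ k, mfderiv (𝓡 3) (𝓡∂ 4) b₁.incl y (uu k) = mfderiv (𝓡∂ 4) (𝓡∂ 4) D₁.jA a₁ (v₁ k)) ∧ (∀ k, mfderiv (𝓡 3) (𝓡∂ 4) (b₂.incl ∘ φ) y (uu k) = mfderiv (𝓡∂ 4) (𝓡∂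 4) D₂.jA a₂ (v₂ k)) ∧ Literature.Geometry.Symplectic.IsPosBdryFrame (fun i : Fin P.length => h (Fin.cast List.length_append.symm (Fin.castAdd N.length i))) a₁ v₁ ∧ Literature.Geometry.Symplectic.IsPosBdryFrame h₂ a₂ v₂) ∧ ConnectedSpace b₁.carrier := by
  intro M _ _ _ _ _ g P N hM hNs hnz
  obtain ⟨X, _, _, _, _, _, _, h, D, bX, Ψ, hlink, hglue, hpage⟩ := hM
  have hN0 : ∀ x ∈ N, x.1 ≠ 0 := fun x hx => hnz x (List.mem_append_right P hx)
  -- X6's constant `κ₀` (binding points have shallow suffix-tube preimages for `κ ≤ κ₀`)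
  obtain ⟨κ₀, hκ₀, Hbind'⟩ := T3_bind g P N h hlink
  -- V5: the compatible split `X₁ = Base g ∪ (prefix)`, suffix data `D₂'` on `X`
  obtain ⟨X₁, _, _, _, _, _, _, D₁, D₂', hA, hB, hC⟩ :=
    exists_compatible_split P.length N.length (List.length_append (as := P) (bs := N)) h D
  -- V5: the standard form of the gluing around the suffix belt circles; `Ψ := G.φ`
  haveI : Nonempty bX.carrier := by
    obtain ⟨y₀⟩ := nonempty_bBase_carrier g
    exact ⟨Ψ.symm y₀⟩
  have hsi := suffix_injective (List.length_append (as := P) (bs := N))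
  obtain ⟨G, aC, col, hφ, ha, ⟨e⟩, hCM, hcol⟩ :=
    exists_standardForm D (fun j : Fin N.length => Fin.cast List.length_append.symm (Fin.natAdd P.length j)) hsi
      bX (bBase g) Ψ hglue
  subst hφ
  -- the constants
  obtain ⟨κ, hκ, hκ2, hκ0⟩ : ∃ κ : ℝ, 0 < κ ∧ κ ≤ 1 / 2 ∧ κ ≤ κ₀ :=
    ⟨min (1 / 2) κ₀, lt_min (by norm_num) hκ₀, min_le_left _ _, min_le_right _ _⟩
  have hκ1 : κ ≤ 1 := hκ2.trans (by norm_num)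
  obtain ⟨δ, hδ, hδ2, haδ⟩ : ∃ δ : ℝ, 0 < δ ∧ δ ≤ 1 / 2 ∧ aC * δ ≤ 1 / 5 := by
    refine ⟨min (1 / 2) (1 / (5 * aC)), lt_min (by norm_num) (by positivity), min_le_left _ _, ?_⟩
    calc aC * min (1 / 2) (1 / (5 * aC)) ≤ aC * (1 / (5 * aC)) :=
          mul_le_mul_of_nonneg_left (min_le_right _ _) ha.le
      _ = 1 / 5 := by field_simp
  -- Y5: the pushed prefix embedding
  obtain ⟨jX₁, hemb, hrng, hYa, hYb, hYc, hYc'⟩ :=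
    exists_pushedPrefixEmbedding D₂' G.isSmoothEmbedding_jM hκ hκ2 hδ hδ2
  have H2 : ∀ y : X, (∀ (j : Fin N.length) (b : ↥(beltPiece 3 2)),
      D.jB (Fin.cast List.length_append.symm (Fin.natAdd P.length j)) b ≠ y) → G.jM y ∈ range jX₁ :=
    fun y hy => jM_mem_range_of_forall_ne D
      (fun j : Fin N.length => Fin.cast List.length_append.symm (Fin.natAdd P.length j)) D₂' hC G.jM hYc' hy
  have H3 : ∀ (j : Fin N.length) (b : ↥(beltPiece 3 2)),
      G.jM (D.jB (Fin.cast List.length_append.symm (Fin.natAdd P.length j)) b) ∈ range jX₁ ↔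
        0 < ‖lamPart ((b : closedBall (0 : EuclideanSpace ℝ (Fin 4)) 1) : EuclideanSpace ℝ (Fin 4))‖ ^ 2 ∧
          0 ≤ modelH κ δ ((b : closedBall (0 : EuclideanSpace ℝ (Fin 4)) 1) : EuclideanSpace ℝ (Fin 4)) :=
    fun j b => by rw [← hC]; exact hYc j b
  -- Y6: the complement piece `W₂ = {Φ ≤ 0}` on the concrete regular sublevel set
  have hΦ := isRegularLevel_levelFn D (fun j : Fin N.length => Fin.cast List.length_append.symm (Fin.natAdd P.length j))
    G ha hsi hCM hκ hκ2 hδ hδ2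
  obtain ⟨φ, hglue', hseamId, -, -, -, -, -⟩ :=
    exists_complementPiece_concrete D (fun j : Fin N.length => Fin.cast List.length_append.symm (Fin.natAdd P.length j))
      G ha hsi hCM hκ hκ2 hδ hδ2 hΦ hemb hrng H2 H3
  have hglueM := isBoundaryGluing_of_diffeomorph hglue' e
  -- X1: the dual data on `W₂`
  obtain ⟨D₂, hE1s, hE2⟩ := helper_exists_dualAttachmentData D (fun j : Fin N.length => Fin.cast List.length_append.symm (Fin.natAdd P.length j))
    G col ha hsi hCM hκ hκ2 hκ1 hδ hδ2 haδ hcol hΦ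
  -- (E1) in the closed form (X1 exports the strict one)
  have hE1 : ∀ w : ↥(coresComplement fun j : Fin N.length =>
      dualMap D bX (bBase g) G.φ col κ δ hκ hκ1 hδ hδ2 (Fin.cast List.length_append.symm (Fin.natAdd P.length j))),
      (∀ (j : Fin N.length) (y : ↥(handleTube 3 2)),
        (dualMap D bX (bBase g) G.φ col κ δ hκ hκ1 hδ hδ2 (Fin.cast List.length_append.symm (Fin.natAdd P.length j))).toFun y =
          (w : Base g) → lamSq 2 ((y : closedBall (0 : EuclideanSpace ℝ (Fin 4)) 1) : EuclideanSpace ℝ (Fin 4)) ≤ 1 / 4) →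
      RegularSublevel.incl hΦ (D₂.jA w) = G.jN w :=
    apply_eq_of_forall_lamSq_le _ D₂.disjoint (fun w => RegularSublevel.incl hΦ (D₂.jA w))
      ((RegularSublevel.isSmoothEmbedding_incl hΦ).isEmbedding.continuous.comp D₂.hjA.isEmbedding.continuous) G.jN
      G.isSmoothEmbedding_jN.isEmbedding.continuous hE1s
  -- THE SEAM CLAUSE (shallow form)
  have hseam := fun (y : (BoundaryManifold.boundaryData 3 X₁).carrier) (a : ↥(coresComplement h))
      (ha₁ : (a : Base g) ∈ coresComplement
        fun i : Fin P.length => h (Fin.cast List.length_append.symm (Fin.castAdd N.length i)))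
      (z : bX.carrier) (hz : D.jA a = bX.incl z)
      (hy : (BoundaryManifold.boundaryData 3 X₁).incl y = D₁.jA ⟨a, ha₁⟩)
      (hsh : ∀ (j : Fin N.length) (t : ↥(handleTube 3 2)),
        (h (Fin.cast List.length_append.symm (Fin.natAdd P.length j))).toFun t = (a : Base g) →
        ‖lamPart ((t : closedBall (0 : EuclideanSpace ℝ (Fin 4)) 1) : EuclideanSpace ℝ (Fin 4))‖ ^ 2 ≤
          1 - 3 * κ ^ 2 / 4) =>
    seam_clause_shallow P.length N.length (List.length_append (as := P) (bs := N)) D D₁ D₂' hA G col κ δ hκ hκ1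
      hδ hδ2 jX₁ hYa (RegularSublevel.boundaryData hΦ) (RegularSublevel.incl hΦ) (RegularSublevel.injective_incl hΦ)
      φ hseamId D₂ hE1 y a ha₁ z hz hy hsh
  -- T3c-3 (Z7) from T3c-1′ (Y1) and T3c-2 (Y3) with ST4 (X3)
  obtain ⟨s', h', hp', hsh', htw', hdj', htr'⟩ :=
    node_dualLink_pageLink_of_universal_nodes
      (fun g l h hlink X _ _ _ _ _ _ D η hη hηπ => helper_belt_isotopic_pushoff g l h hlink D η hη hηπ)
      (fun g l h hlink X _ _ _ _ _ _ D bX Ψ hpage =>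
        node_seam_transport_of_twistSign D bX Ψ hlink hpage (HST4 g l h hlink D bX Ψ hpage))
      g P N h hlink D bX G.φ hpage col κ δ hκ hκ1 hδ hδ2 hN0 hNs
  have hmult' := htr' (RegularSublevel hΦ) D₂.isMultiAttachment
  -- the page presentation WITH DATA (unassigned node)
  obtain ⟨q₂, D₂p, s, hq₂p, hq₂s, hq₂t, ⟨y₀, a₁, a₂, hy₀, hy₀', Hχ⟩, R1p, R2p⟩ :=
    Hgap g P N h hlink D bX G.φ hpage D₁ (RegularSublevel.boundaryData hΦ) φ col κ δ hκ hκ1 hδ hδ2 D₂ hseam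
      s' h' hp' hsh' htw' hdj' hmult'
  -- X4: the sign pin and the ORSEAM frame
  obtain ⟨τ, h₂, D₂'', hτw, -, hττ, hh₂, hjA'', -, hpage₂, hshadow₂, htwist₂, horseam⟩ :=
    helper_dualPresentation_signPin g (Fin P.length) (Fin N.length)
      (fun i : Fin P.length => h (Fin.cast List.length_append.symm (Fin.castAdd N.length i))) X₁ D₁
      (BoundaryManifold.boundaryData 3 X₁) (RegularSublevel hΦ) (RegularSublevel.boundaryData hΦ) φ q₂ D₂p s
      hq₂p hq₂s hq₂t y₀ a₁ a₂ hy₀ hy₀' Hχ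
  obtain ⟨hτ₁, hτ₂⟩ := mem_coresComplement_of_transport_invol τ hττ hh₂
  -- the bridges from `D₂''` to the dual data `D₂`
  have R1 : ∀ a'' : ↥(coresComplement h₂), ∃ (a' : ↥(coresComplement fun j : Fin N.length =>
      dualMap D bX (bBase g) G.φ col κ δ hκ hκ1 hδ hδ2 (Fin.cast List.length_append.symm (Fin.natAdd P.length j))))
      (c : ℝ), 0 < c ∧ D₂''.jA a'' = D₂.jA a' ∧ w g (a'' : Base g).1 = (c : ℂ) * w g (a' : Base g).1 := by
    intro a''
    obtain ⟨a', c, hc, hpa, hwa⟩ := R1p ⟨τ a'', hτ₁ a''⟩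
    have hja : D₂''.jA a'' = D₂p.jA ⟨τ a'', hτ₁ a''⟩ := hjA'' a'' ⟨τ a'', hτ₁ a''⟩ rfl
    have hw'' : w g (a'' : Base g).1 = w g (τ (a'' : Base g)).1 := (hτw (a'' : Base g)).symm
    exact ⟨a', c, hc, hja.trans hpa, hw''.trans hwa⟩
  have R2 : ∀ a' : ↥(coresComplement fun j : Fin N.length =>
      dualMap D bX (bBase g) G.φ col κ δ hκ hκ1 hδ hδ2 (Fin.cast List.length_append.symm (Fin.natAdd P.length j))),
      ∃ a'' : ↥(coresComplement h₂), D₂''.jA a'' = D₂.jA a' := by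
    intro a'
    obtain ⟨ap, hap⟩ := R2p a'
    have hmem : (τ ap : Base g) ∈ coresComplement h₂ := hτ₂ ap
    have hrel : (ap : Base g) = τ ((⟨τ ap, hmem⟩ : ↥(coresComplement h₂)) : Base g) := by
      rw [hττ]
    exact ⟨⟨τ ap, hmem⟩, (hjA'' ⟨τ ap, hmem⟩ ap hrel).trans hap⟩
  -- X5: the seam page function (extra inputs: joint surjectivity of the index maps, (E1) off the dual
  -- ranges, (F1) = X1's (E2), V4's belt clause)
  have hef := mem_range_prefix_or_suffix P N
  have hE1' : ∀ (w : Base g) (hw : w ∈ coresComplement fun j : Fin N.length =>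
      dualMap D bX (bBase g) G.φ col κ δ hκ hκ1 hδ hδ2 (Fin.cast List.length_append.symm (Fin.natAdd P.length j))),
      (∀ (j : Fin N.length) (y : ↥(handleTube 3 2)),
        (dualMap D bX (bBase g) G.φ col κ δ hκ hκ1 hδ hδ2 (Fin.cast List.length_append.symm (Fin.natAdd P.length j))).toFun y ≠ w) →
      RegularSublevel.incl hΦ (D₂.jA ⟨w, hw⟩) = G.jN w :=
    fun w hw hne => hE1 ⟨w, hw⟩ fun j y hy => absurd hy (hne j y)
  have hbelt := w_incl_ne_zero_of_belt g (P ++ N) h D bX G.φ hlink hpage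
  obtain ⟨F, hFs, hF₁, hF₂, hF0, hFd⟩ :=
    exists_seamPageFunction D G (fun i : Fin P.length => Fin.cast List.length_append.symm (Fin.castAdd N.length i))
      (fun j : Fin N.length => Fin.cast List.length_append.symm (Fin.natAdd P.length j)) hsi hef
      (disjoint_range_natAdd_castAdd (List.length_append (as := P) (bs := N)) D) D₁ D₂' hA hB hC ha hκ hκ2 hκ1
      hδ hδ2 col hCM hcol hYa hYb (RegularSublevel.boundaryData hΦ) (RegularSublevel.injective_incl hΦ) φ hseamId
      D₂ hE1' hE2 hpage hbelt
  -- X6: connectedness of the seam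
  have hconn := helper_T3_connected g
    (fun i : Fin P.length => h (Fin.cast List.length_append.symm (Fin.castAdd N.length i))) X₁ D₁
    (BoundaryManifold.boundaryData 3 X₁)
  refine ⟨h, X₁, inferInstance, inferInstance, inferInstance, inferInstance, inferInstance, inferInstance, D₁,
    RegularSublevel hΦ, inferInstance, inferInstance, inferInstance, inferInstance, inferInstance, inferInstance,
    BoundaryManifold.boundaryData 3 X₁, RegularSublevel.boundaryData hΦ, φ, h₂, D₂'', F, hlink, hglueM, hpage₂,
    hshadow₂, htwist₂, hFs, hF₁, ?_, hF0, hFd, ?_, horseam, hconn⟩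
  · -- (ii-c) for `D₂''` through (R1)
    intro y a'' hy
    obtain ⟨a', c, hc, hja, hwa⟩ := R1 a''
    obtain ⟨c₁, hc₁, hF⟩ := hF₂ y a' (hy.trans hja)
    refine ⟨c₁ / c, div_pos hc₁ hc, ?_⟩
    have hc0 : (c : ℂ) ≠ 0 := by exact_mod_cast hc.ne'
    rw [hF, hwa, ← mul_assoc]
    congr 1
    push_cast
    rw [div_mul_cancel₀ _ hc0]
  · -- (iii) for `D₂''` through (R2)
    intro y a hy hw
    obtain ⟨a', ha'⟩ := Hbind' D bX G.φ hpage D₁ (RegularSublevel.boundaryData hΦ) φ col κ δ hκ hκ1 hδ hδ2 hκ0 D₂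
      hseam y a hy hw
    obtain ⟨a'', ha''⟩ := R2 a'
    exact ⟨a'', ha'.trans ha''.symm⟩


/-! ### §3 Registered helper -/

/-- **Sub-goal `helper_w_incl_ne_zero_of_belt` of stub `stub_T3_dualPresentation`** (T3 (ii) input;
wave 5, lead c5): the page value at the deep belt points of the seam is non-zero
(`w_incl_ne_zero_of_belt`, fully qualified registered text). [cite: EtnyreFuller2006, Thm. 1 (proof, p. 8)] -/
theorem helper_w_incl_ne_zero_of_belt : ∀ (g : ℕ) (l : List ((Fin g ⊕ Fin g → ℤ) × Bool)) {X : Type} [TopologicalSpace X] [T2Space X] [SecondCountableTopology X] [CompactSpace X] [ChartedSpace (EuclideanHalfSpace 4) X] [IsManifold (𝓡∂ 4) ∞ X] (h : Fin l.length → Literature.Topology.FourManifolds.HandleAttachingMap 3 2 (Literature.Topology.FourManifolds.LefschetzBase.Base g)) (D : Literature.Topology.FourManifolds.HandleAttachingMap.MultiAttachmentData h (𝓡∂ 4) X) (bX : Literature.Topology.FourManifolds.BoundaryData (𝓡∂ 4) X (𝓡 3)) (Ψ : bX.carrier ≃ₘ⟮𝓡 3, 𝓡 3⟯ (Literature.Topology.FourManifolds.LefschetzBase.bBase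 g).carrier), Literature.Topology.FourManifolds.LefschetzBase.IsLefschetzLink g l h → (∀ (y : bX.carrier) (a : ↥(Literature.Topology.FourManifolds.HandleAttachingMap.coresComplement h)), bX.incl y = D.jA a → ∃ c : ℝ, 0 < c ∧ Literature.Topology.FourManifolds.LefschetzBase.w g ((Literature.Topology.FourManifolds.LefschetzBase.bBase g).incl (Ψ y)).1 = (c : ℂ) * Literature.Topology.FourManifolds.LefschetzBase.w g (a : Literature.Topology.FourManifolds.LefschetzBase.Base g).1) → ∀ (y : bX.carrier) (k : Fin l.length) (b : ↥(Literature.Topology.FourManifolds.beltPiece 3 2)), bX.incl y = D.jB k b → bX.incl y ∉ Set.range D.jA → Literature.Topology.FourManifolds.LefschetzBase.w g ((Literature.Topology.FourManifolds.LefschetzBase.bBase g).incl (Ψ y)).1 ≠ 0 :=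
  fun g l _ _ _ _ _ _ _ h D bX Ψ hlink hpage y k b hy hdeep => w_incl_ne_zero_of_belt g l h D bX Ψ hlink hpage y k b hy hdeep

end Summit.SmoothPoincare4.SmoothPoincare4.Theorems.AcyclicBisectionExists.ModpBraidOrbits

end
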